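import Summits.HodgeConjecture.HodgeConjecture.Theorems.VHCAbelianSchemesRoadIsogenyTwistPushforwardIso
import Literature.AlgebraicGeometry.HodgeTheory.HodgeSheafPullbackForms
import Literature.AlgebraicGeometry.Modules.EpiChainStabilizes
import Literature.AlgebraicGeometry.Morphisms.CohOfVectorBundle
import Literature.AlgebraicGeometry.Motives.AbelianVarietyIsogenyEtale
import Literature.AlgebraicGeometry.Motives.AbelianVarietyAmpleProofs
import HarnessLib

/-!
# Road №4 (`VHCAbelianSchemesRoad`) — (P2′) `dg` on `q`-forms IS AN ISOMORPHISM for every isogeny of a complex abelian variety: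
# the `dite` of the twist datum (L7b) `isogenyTwistPushforwardIsoFamily` collapses (crux stmt-HodgeConjecture-26512, THEOREM T′)

research route conditional on HC_CM; not a corollary; Q11.4-sentence-2 already refuted in dim ≥ 3.

Seat core-w6 (width copy of core-D), sequel of `Theorems/VHCAbelianSchemesRoadIsogenyTwistPushforwardIso.lean` (the data node (L7b)
`IsogenyTwistPushforwardIso A g` in the free-cotangent model composed with `dg`, where the `dg`-twist `isogenyFormsTwist` is a `dite` on
`IsIso (isogenyPullbackForms A g q)`). `--supports stmt-HodgeConjecture-26512 --as helper`; closes NO stub; CONDITIONAL on the ONE named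
fact «`Ω¹_A` free» (`Mumford1970_cotangentSheaf_abelianVariety_free`, the hypothesis `hΩ`); nothing here says (AtPair), (TrPair), (c1), T′,
`HC_AV`, `HC_CM` or HC holds; HC_CM HELD, by name only; typed ≠ proved.

WHAT IS PROVED.
* `isIso_of_epi_of_coh` — an epi ENDOMORPHISM of a coherent module on a noetherian scheme is an isomorphism (the tree's chain
  stabilisation `Modules/EpiChainStabilizes.exists_forall_isIso_of_epi_chain` on the powers of `φ`; Vasconcelos ∕ Stacks 05G8 in sheaf form).
* **`isIso_isogenyPullbackForms hΩ A g hg q : IsIso (isogenyPullbackForms A g q)`** — `dg : g^*Ω^q_A ⟶ Ω^q_A` is an isomorphism for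
  every isogeny `g` of a complex abelian variety: an isogeny in characteristic `0` is étale, so formally unramified
  (`IsIsogeny.formallyUnramified`), so `dg` is an epimorphism (`Literature/AlgebraicGeometry/HodgeTheory/HodgeSheafPullbackForms.lean`,
  `epi_pullbackForms`; the affine sections of `Ω¹_A` are free from the global frame); `g^*Ω^q_A ≅ 𝒪^N ≅ Ω^q_A` abstractly (global frame
  + Mathlib `pullbackObjFreeIso`), so `(Ω^q ≅ g^*Ω^q) ≫ dg` is an epi endomorphism of the coherent `Ω^q_A` on the noetherian `A`
  (`AbelianVariety.isNoetherian_left`), hence an isomorphism.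
* **`isogenyFormsTwist_eq`** — the `dg`-twist of (L7b) with its `dite` COLLAPSED: `θ_q(g) = dg⁻¹ ≫ g^*(frame) ≫ (g^*𝒪^N ≅ 𝒪^N) ≫ frame⁻¹`
  outright; so `α₀ = isogenyTwistPushforwardIsoFamily hΩ` is, by proof and not only by truth, the frame comparison precomposed with the
  honest `dg`-twist — the form the owners of `stub_atiyahPair` ∕ `stub_tracePair` unfold.

References: [cite: Hartshorne1977, II Prop. 8.11 and III Prop. 10.4] [cite: MumfordAV1970, §4 (iii) (p. 42) and §7 Thm. 4 (p. 72)]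
[cite: GortzWedhorn2023, Prop. 24.102 (proof) and Cor. 27.63] [cite: StacksProject, Tag 05G8].
-/

noncomputable section

-- `TopCat.Presheaf`/`Scheme.Modules` are not reducible (as in Mathlib's `AlgebraicGeometry/Modules/Sheaf.lean`).
set_option backward.isDefEq.respectTransparency false

open CategoryTheory CategoryTheory.Limits AlgebraicGeometry Opposite TopologicalSpace
open AlgebraicGeometry.Scheme.Modules

namespace Summit.HodgeConjecture.HodgeConjecture.Ring2.SemiregularRepresentatives

set_option linter.dupNamespace false -- the cell's namespace repeats the summit name, as in every `Ring2*` file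

open Literature.AlgebraicGeometry Literature.AlgebraicGeometry.Modules Literature.AlgebraicGeometry.Motives
open Literature.AlgebraicGeometry.Motives.AbelianVariety Literature.AlgebraicGeometry.HodgeTheory
open Literature.AlgebraicGeometry.KTheory Literature.AlgebraicGeometry.Morphisms

/-! ## §5 The isogeny case: `dg` on `q`-forms is an ISOMORPHISM (the `dite` of `isogenyFormsTwist` collapses) -/

section Isogeny

/-- `isogenyPullbackForms` IS `pullbackForms` of the underlying morphism of `ℂ`-schemes (definitional). [folklore] -/
theorem isogenyPullbackForms_eq (A : AbelianVariety ℂ) (g : A ⟶ A) (q : ℕ) :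
    isogenyPullbackForms A g q = pullbackForms g.hom.hom.hom q := rfl

/-- **An epi ENDOMORPHISM of a coherent module on a noetherian scheme is an isomorphism** (surjective endomorphisms of finitely
generated modules over noetherian rings are injective; sheaf form via the tree's chain stabilisation `exists_forall_isIso_of_epi_chain`
applied to the powers of `φ`). [cite: GortzWedhorn2023, Prop. 24.102 (proof)] [cite: StacksProject, Tag 05G8] -/
theorem isIso_of_epi_of_coh {X : Scheme.{0}} [IsLocallyNoetherian X] [CompactSpace X] {M : X.Modules} (hM : Coh M)
    (φ : M ⟶ M) [Epi φ] : IsIso φ := by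
  -- the chain `M ↠ M ↠ M ↠ ⋯` with `ψ_n = φ^{n+1}`, `μ_n = φ`
  let ψ : ℕ → (M ⟶ M) := fun n => Nat.rec φ (fun _ f => f ≫ φ) n
  have hψ0 : ψ 0 = φ := rfl
  have hψs : ∀ n, ψ (n + 1) = ψ n ≫ φ := fun n => rfl
  have hepi : ∀ n, Epi (ψ n) := fun n => by
    induction n with
    | zero => rw [hψ0]; infer_instance
    | succ n ih => rw [hψs]; exact epi_comp _ _
  obtain ⟨n₀, hn₀⟩ := exists_forall_isIso_of_epi_chain hM (fun _ => hM) ψ hepi (fun _ => φ) (fun n => (hψs n).symm)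
  exact hn₀ n₀ le_rfl

/-- **(P2′) — `dg` ON `q`-FORMS IS AN ISOMORPHISM FOR EVERY ISOGENY OF A COMPLEX ABELIAN VARIETY** (granted the named fact «Ω¹_A
free»): `IsIso (isogenyPullbackForms A g q)`. Proof: an isogeny in characteristic `0` is étale, in particular formally unramified
(`IsIsogeny.formallyUnramified`), so `dg` is an epimorphism (§4; the affine sections of `Ω¹_A` are free since `Ω¹_A` is globally
free); `g^*Ω^q_A ≅ 𝒪^N ≅ Ω^q_A` abstractly (the global frame + Mathlib `pullbackObjFreeIso`), so `(Ω^q ≅ g^*Ω^q) ≫ dg` is an epi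
ENDOMORPHISM of the coherent `Ω^q_A` on the noetherian `A`, hence an isomorphism (`isIso_of_epi_of_coh`). CONDITIONAL on `hΩ`.
[cite: Hartshorne1977, III Prop. 10.4 and II Prop. 8.11] [cite: MumfordAV1970, §4 (iii) (p. 42) and §7 Thm. 4 (p. 72)] -/
theorem isIso_isogenyPullbackForms (hΩ : Mumford1970_cotangentSheaf_abelianVariety_free) (A : AbelianVariety ℂ) (g : A ⟶ A)
    (hg : IsIsogeny g) (q : ℕ) : IsIso (isogenyPullbackForms A g q) := by
  haveI := hg.formallyUnramified
  haveI := A.isNoetherian_left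
  -- freeness of the affine sections of `Ω¹_A` from the global frame
  have hfree : ∀ U : A.X.left.Opens, IsAffineOpen U → Module.Free Γ(A.X.left, U) Γ(cotangentSheaf A.X, U) := fun U _ => by
    obtain ⟨b, -⟩ := exists_basis_sections_of_iso_free (hΩ ℂ A).some
    exact Module.Free.of_basis (b U)
  haveI : Epi (isogenyPullbackForms A g q) := epi_pullbackForms g.hom.hom.hom q hfree
  -- the abstract isomorphism `Ω^q ≅ g^*Ω^q` and the epi endomorphism
  haveI := final_opensMap (Hom.toSchemeHom g)
  let e : hodgeSheaf A.X q ≅ (Scheme.Modules.pullback (Hom.toSchemeHom g)).obj (hodgeSheaf A.X q) :=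
    hodgeSheafFreeIso hΩ A q ≪≫ (SheafOfModules.pullbackObjFreeIso _ (Fin (A.dim.choose q))).symm ≪≫
      (Scheme.Modules.pullback (Hom.toSchemeHom g)).mapIso (hodgeSheafFreeIso hΩ A q).symm
  have hcoh : Coh (hodgeSheaf A.X q) :=
    coh_of_isVectorBundle (isFiniteLocallyFree_hodgeSheaf_abelianVariety_of_free hΩ A q).isVectorBundle
  haveI : IsIso (e.hom ≫ isogenyPullbackForms A g q) := isIso_of_epi_of_coh hcoh _
  exact IsIso.of_isIso_comp_left e.hom (isogenyPullbackForms A g q)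

/-- **The `dg`-twist with the `dite` collapsed**: for an isogeny, `θ_q(g) = dg⁻¹ ≫ g^*(frame) ≫ (g^*𝒪^N ≅ 𝒪^N) ≫ frame⁻¹` outright
(so `α₀ = isogenyTwistPushforwardIsoFamily hΩ` IS the frame comparison precomposed with the honest `dg`-twist). CONDITIONAL on `hΩ`.
[cite: Hartshorne1977, III Prop. 10.4] [cite: MumfordAV1970, §7 Thm. 4 (p. 72)] -/
theorem isogenyFormsTwist_eq (hΩ : Mumford1970_cotangentSheaf_abelianVariety_free) (A : AbelianVariety ℂ) (g : A ⟶ A)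
    (hg : IsIsogeny g) (q : ℕ) :
    isogenyFormsTwist hΩ A g q =
      haveI := isIso_isogenyPullbackForms hΩ A g hg q
      haveI := final_opensMap (Hom.toSchemeHom g)
      (asIso (isogenyPullbackForms A g q)).symm ≪≫
        (Scheme.Modules.pullback (Hom.toSchemeHom g)).mapIso (hodgeSheafFreeIso hΩ A q) ≪≫
          SheafOfModules.pullbackObjFreeIso _ (Fin (A.dim.choose q)) ≪≫ (hodgeSheafFreeIso hΩ A q).symm :=
  haveI := isIso_isogenyPullbackForms hΩ A g hg q
  isogenyFormsTwist_of_isIso hΩ A g q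

end Isogeny

end Summit.HodgeConjecture.HodgeConjecture.Ring2.SemiregularRepresentatives

end
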